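import Summits.QuantumFields.YangMills.Theorems.ColdStartUniversalityLatticeLangevinDossSussmannSmoothing
import HarnessLib

/-!
# Route `ColdStartUniversality` (fixed-cut-off SZZ dynamics; Doss–Sussmann smoothing programme, file 6):
# `P_t(C¹) ⊂ C¹` IN THE TREE'S FLAT REAL LINK COORDINATES

Helper file (seat `ym-line-csu-p1`, g24).  The tree's cylinder functions (generator-form Poincaré / log-Sobolev files,
`dynkin_expectation_szz`, …) are `f ∘ coords` with `f : (Edge 3 L × Fin 2 × Fin 2 × Bool → ℝ) → ℝ` a function of the
REAL link coordinates `coords V q = Re/Im (V_{q.1})_{q.2.1 q.2.2.1}`.  ★★★ `markovTransition_contDiff_one_flat` restates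
`markovTransition_contDiff_one` (complex ambient coordinates) in that language: for every `C¹` such `f` there is a `C¹`
`g` with `𝔼 f(coords U^x_t) = g(coords x)` for all `x ∈ SU(2)^E` (the two coordinate systems differ by a real-linear
isomorphism `Re/Im ↔ (re, im)`).
THEOREMS ONLY, no sorry.  HONEST FRAMING: fixed-cut-off regularity; nothing K-uniform; no crux, rung or summit statement
is proved; the Yang–Mills mass gap is NOT proved.
-/

set_option autoImplicit false

noncomputable section

namespace Summit.QuantumFields.YangMills.Theorems.ColdStartUniversality

open MeasureTheory Finset Filter Set Metric Function
open scoped NNReal Matrix Topology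
open Literature.MathematicalPhysics.QuantumFieldTheory
open Literature.MathematicalPhysics.QuantumLattice (fundamentalRep fundamentalLatticeRep continuous_fundamentalRep
  fundamentalRep_mem_unitaryGroup)

variable {L : ℕ}

/-- The passage from complex ambient coordinates `Edge → (Fin 2 → Fin 2 → ℂ)` to the flat real coordinates
`Edge × Fin 2 × Fin 2 × Bool → ℝ` (`Re`/`Im` entrywise) is `C^∞` (real-linear). [folklore] -/
theorem contDiff_toFlat [NeZero L] {n : WithTop ℕ∞} :
    ContDiff ℝ n fun (M : Edge 3 L → Fin (fundamentalLatticeRep 2).N → Fin (fundamentalLatticeRep 2).N → ℂ)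
      (q : Edge 3 L × Fin 2 × Fin 2 × Bool) =>
        (fun z : ℂ => if q.2.2.2 then z.im else z.re) (M q.1 q.2.1 q.2.2.1) := by
  refine contDiff_pi.2 fun q => ?_
  have hentry : ContDiff ℝ n fun M : Edge 3 L → Fin (fundamentalLatticeRep 2).N →
      Fin (fundamentalLatticeRep 2).N → ℂ => M q.1 q.2.1 q.2.2.1 :=
    contDiff_pi.1 (contDiff_pi.1 (contDiff_pi.1 contDiff_id q.1) q.2.1) q.2.2.1
  rcases q with ⟨e, k, l, b⟩
  cases b
  · simp only [Bool.false_eq_true, ↓reduceIte]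
    exact Complex.reCLM.contDiff.comp hentry
  · simp only [↓reduceIte]
    exact Complex.imCLM.contDiff.comp hentry

/-- The passage from the flat real coordinates back to complex ambient coordinates (`(re, im) ↦ re + im·i` entrywise)
is `C^∞` (real-linear). [folklore] -/
theorem contDiff_ofFlat [NeZero L] {n : WithTop ℕ∞} :
    ContDiff ℝ n fun (y : Edge 3 L × Fin 2 × Fin 2 × Bool → ℝ) (e : Edge 3 L)
      (k l : Fin (fundamentalLatticeRep 2).N) => (⟨y (e, k, l, false), y (e, k, l, true)⟩ : ℂ) := by
  refine contDiff_pi.2 fun e => contDiff_pi.2 fun k => contDiff_pi.2 fun l => ?_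
  exact contDiff_complex_mk (contDiff_apply ℝ ℝ (e, k, l, false)) (contDiff_apply ℝ ℝ (e, k, l, true))

/-- ★★★ **`P_t(C¹) ⊂ C¹` in flat coordinates.**  In the setting of `markovTransition_contDiff_one` (SZZ dynamics on
`SU(2)^E` at fixed cut-off, regular solution families `B` (free) and `U` (coupling `β`) on one flat noise, `t ≥ 0`):
for every `C¹` function `f` of the real link coordinates there is a `C¹` function `g` of the real link coordinates with
`𝔼 f(coords U^x_t) = g(coords x)` for all `x ∈ SU(2)^E`, `coords V q = Re/Im (V_{q.1})_{q.2.1 q.2.2.1}` — the transition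
operator preserves the tree's `C¹` cylinder class. [folklore] -/
theorem markovTransition_contDiff_one_flat [NeZero L] (β : ℝ)
    {Ω : Type} [MeasurableSpace Ω] {P : Measure Ω} [IsProbabilityMeasure P]
    {W : ℝ≥0 → Ω → (Edge 3 L × NoiseIdx 2 → ℝ)} (hW : IsFlatBrownian W P)
    (B U : GaugeConfig 3 L (Matrix.specialUnitaryGroup (Fin 2) ℂ) → ℝ≥0 → Ω →
      GaugeConfig 3 L (Matrix.specialUnitaryGroup (Fin 2) ℂ))
    (hB : ∀ x, (∀ ω, B x 0 ω = x) ∧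
      (latticeLangevinDynamics (fundamentalLatticeRep 2) 0).IsSolution (fundamentalRep (Fin 2)) hW.natFiltration P W (B x))
    (hBm : ∀ i : ℝ≥0, Measurable[@Prod.instMeasurableSpace (Set.Iic i)
        (GaugeConfig 3 L (Matrix.specialUnitaryGroup (Fin 2) ℂ) × Ω) inferInstance
        (@Prod.instMeasurableSpace (GaugeConfig 3 L (Matrix.specialUnitaryGroup (Fin 2) ℂ)) Ω inferInstance
          (hW.natFiltration i))]
      (fun q : Set.Iic i × (GaugeConfig 3 L (Matrix.specialUnitaryGroup (Fin 2) ℂ) × Ω) => B q.2.1 q.1 q.2.2))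
    (hU : ∀ x, (∀ ω, U x 0 ω = x) ∧
      (latticeLangevinDynamics (fundamentalLatticeRep 2) β).IsSolution (fundamentalRep (Fin 2)) hW.natFiltration P W (U x))
    (hUm : ∀ i : ℝ≥0, Measurable[@Prod.instMeasurableSpace (Set.Iic i)
        (GaugeConfig 3 L (Matrix.specialUnitaryGroup (Fin 2) ℂ) × Ω) inferInstance
        (@Prod.instMeasurableSpace (GaugeConfig 3 L (Matrix.specialUnitaryGroup (Fin 2) ℂ)) Ω inferInstance
          (hW.natFiltration i))]
      (fun q : Set.Iic i × (GaugeConfig 3 L (Matrix.specialUnitaryGroup (Fin 2) ℂ) × Ω) => U q.2.1 q.1 q.2.2))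
    (t : ℝ≥0) {f : (Edge 3 L × Fin 2 × Fin 2 × Bool → ℝ) → ℝ} (hf : ContDiff ℝ 1 f) :
    ∃ g : (Edge 3 L × Fin 2 × Fin 2 × Bool → ℝ) → ℝ, ContDiff ℝ 1 g ∧
      ∀ x : GaugeConfig 3 L (Matrix.specialUnitaryGroup (Fin 2) ℂ),
        ∫ ω, f (fun q : Edge 3 L × Fin 2 × Fin 2 × Bool => (fun z : ℂ => if q.2.2.2 then z.im else z.re)
            ((fundamentalRep (Fin 2) (U x t ω q.1) : Matrix (Fin 2) (Fin 2) ℂ) q.2.1 q.2.2.1)) ∂P =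
          g (fun q : Edge 3 L × Fin 2 × Fin 2 × Bool => (fun z : ℂ => if q.2.2.2 then z.im else z.re)
            ((fundamentalRep (Fin 2) (x q.1) : Matrix (Fin 2) (Fin 2) ℂ) q.2.1 q.2.2.1)) := by
  -- the two coordinate changes
  obtain ⟨θ, hθ⟩ : ∃ θ : (Edge 3 L → Fin (fundamentalLatticeRep 2).N → Fin (fundamentalLatticeRep 2).N → ℂ) →
      (Edge 3 L × Fin 2 × Fin 2 × Bool → ℝ),
      θ = fun M q => (fun z : ℂ => if q.2.2.2 then z.im else z.re) (M q.1 q.2.1 q.2.2.1) := ⟨_, rfl⟩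
  obtain ⟨ψ, hψ⟩ : ∃ ψ : (Edge 3 L × Fin 2 × Fin 2 × Bool → ℝ) →
      (Edge 3 L → Fin (fundamentalLatticeRep 2).N → Fin (fundamentalLatticeRep 2).N → ℂ),
      ψ = fun y e k l => (⟨y (e, k, l, false), y (e, k, l, true)⟩ : ℂ) := ⟨_, rfl⟩
  have hθs : ContDiff ℝ 1 θ := by rw [hθ]; exact contDiff_toFlat (L := L)
  have hψs : ContDiff ℝ 1 ψ := by rw [hψ]; exact contDiff_ofFlat (L := L)
  have hψθ : ∀ M, ψ (θ M) = M := fun M => by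
    rw [hψ, hθ]; funext e k l
    exact Complex.ext rfl rfl
  -- apply the complex-coordinate theorem to `f ∘ θ`
  obtain ⟨g, hg, hgU⟩ := markovTransition_contDiff_one (L := L) β hW B U hB hBm hU hUm t (f := f ∘ θ) (hf.comp hθs)
  refine ⟨g ∘ ψ, hg.comp hψs, fun x => ?_⟩
  have h1 := hgU x
  have hcoords : ∀ V : GaugeConfig 3 L (Matrix.specialUnitaryGroup (Fin 2) ℂ),
      θ (fun (e : Edge 3 L) (k l : Fin (fundamentalLatticeRep 2).N) => (fundamentalLatticeRep 2).ρ (V e) k l) =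
        fun q : Edge 3 L × Fin 2 × Fin 2 × Bool => (fun z : ℂ => if q.2.2.2 then z.im else z.re)
          ((fundamentalRep (Fin 2) (V q.1) : Matrix (Fin 2) (Fin 2) ℂ) q.2.1 q.2.2.1) := fun V => by
    rw [hθ]; rfl
  simp only [Function.comp_apply, hcoords] at h1
  rw [h1, Function.comp_apply, ← hcoords x, hψθ]

end Summit.QuantumFields.YangMills.Theorems.ColdStartUniversality

end
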